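import Summits.SmoothPoincare4.SmoothPoincare4.Theorems.EntropyRungBakryEmeryLogSobolevGaffneyCutoff
import Summits.SmoothPoincare4.SmoothPoincare4.Theorems.EntropyRungBakryEmeryLogSobolevHessianSlack
import Summits.SmoothPoincare4.SmoothPoincare4.Theorems.EntropyRungNoncompactShrinkerGapHeatGradientDecay
import Literature.Geometry.Riemannian.PerelmanEntropyCutoff
import HarnessLib

/-!
# The dissipation inequality of the gradient subsolution with a first-order (Gaffney) cut-off
# (support item `EntropyRung.BakryEmeryLogSobolev`, stmt-SmoothPoincare4-16587)

Setting: `M` modelled on `ℝⁿ` (Hausdorff, second countable, `T₃`, Borel — NOT compact), `g`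
Riemannian with its Levi-Civita connection, `V` smooth with `Ric + Hess V ≥ K g` (NO other assumption
on `V`), `L = Δ_g − g⁻¹(dV, d·)`; Gaffney cut-offs `η_k` (`0 ≤ η_k ≤ 1`, `η_k ≤ η_{k+1}`, `η_k(x) = 1`
for large `k`, `|∇η_k|² ≤ C₀/(k+1)²`, `exists_gaffney_cutoff`).

This file is the one-cut-off step of the gradient decay `|∇ρ(s)|² ≤ e^{-2Ks} sup|∇ρ₀|²`
(`gaffney_gradientDecay`, `EntropyRungBakryEmeryLogSobolevGradientBound.lean`): the energy method for
the SUBSOLUTION `w = e^{2Ks}|∇ρ|² − G₀` with the linear-growth convex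
test function `Ψ` of `exists_convexTest` and the weights `η_k² e^{-V}`; what makes first-order cut-offs
possible is the Hessian term of the weighted Bochner formula: with the slack
`S = ½L|∇ρ|² − g⁻¹(dρ, d(Lρ)) − K|∇ρ|² ≥ |Hess ρ|² ≥ 0` one has EXACTLY `∂ₛw − Lw = −2e^{2Ks} S`
(`deriv_gradSq_of_heatFlow_isOpen`), while the cut-off error `g⁻¹(dη, dw) = e^{2Ks} g⁻¹(dη, d|∇ρ|²)`
obeys `g⁻¹(dη, d|∇ρ|²)² ≤ 4|∇η|²|∇ρ|² S` (`innerDual_gradSq_sq_le_slack`); hence, for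
`E_k(s) = ∫ Ψ(w(s)) η_k² e^{-V}`,
`E_k' = −∫ η_k²Ψ''(w)|∇w|²e^{-V} − 2∫ Ψ'(w)η_k g⁻¹(dη_k, dw)e^{-V} − 2∫ Ψ'(w)η_k² e^{2Ks} S e^{-V}
≤ 2 e^{2Ks} ∫ Ψ'(w) |∇η_k|² |∇ρ|² e^{-V} ≤ 2e^{2|K|T} C₀/(k+1)² ∫ |∇ρ(s)|² e^{-V}`
(`slack_absorb`), so `0 ≤ E_k(s) ≤ 2e^{2|K|T} C₀/(k+1)² ∫∫|∇ρ|²e^{-V} → 0`; `E_k` is nondecreasing in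
`k`, every `E_k(s)` vanishes, `w ≤ 0`. (Closed case: `heatFlow_gradSq_le`; the shrinker toolkit's
`helper_gradientDecay` uses cut-offs with `|Lη_k| ≤ C` instead.) Everything is proved; no definitions.

## References

* [BakryGentilLedoux2014] D. Bakry, I. Gentil, M. Ledoux (2014), Thm. 3.2.3/3.2.4 and their proofs,
  pp. 143–147 (gradient bounds on a complete manifold through cut-offs `ζ_k`, `Γ(ζ_k) ≤ 1/k`), §C.6.
* [CarrilloNi2009] J. A. Carrillo, L. Ni, Comm. Anal. Geom. 17 (2009), §3 (p. 8) and §4.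
* [Grigoryan2009] A. Grigor'yan (2009), §12.1 (energy method with cut-offs).
-/

noncomputable section

set_option linter.dupNamespace false

open scoped Manifold ContDiff ENNReal NNReal Topology
open MeasureTheory Set Filter
open Literature.Geometry.Lorentzian Literature.Geometry.Riemannian

namespace Summit.SmoothPoincare4.SmoothPoincare4.Theorems.BakryEmeryComplete

open NoncompactShrinkerGapHeat NoncompactShrinkerGapHeat.CutoffToolkit

/-! ### The pointwise absorption behind the gradient bound -/

/-- **Absorption of the cut-off error into the `Γ₂`-slack.** For `ψ' ≥ 0`, `e ≥ 0`, `S, G, Q ≥ 0`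
and `J² ≤ 4 G Q S` (the values of `Ψ'(w)`, `e^{2Ks}`, the slack, `|∇η|²`, `|∇ρ|²`,
`J = g⁻¹(dη, d|∇ρ|²)`): `−2 ψ' η (e J) − 2 ψ' η² e S ≤ 2 ψ' e (G Q)`, because
`(η J)² ≤ 4 η² G Q S ≤ (η² S + G Q)²`. [folklore] -/
theorem slack_absorb {ψ' e J S G Q η : ℝ} (hψ : 0 ≤ ψ') (he : 0 ≤ e) (hS : 0 ≤ S) (hG : 0 ≤ G)
    (hQ : 0 ≤ Q) (hJ : J ^ 2 ≤ 4 * G * Q * S) :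
    -(2 * (ψ' * η * (e * J))) - 2 * (ψ' * η ^ 2 * e * S) ≤ 2 * (ψ' * e * (G * Q)) := by
  have hsq : (η * J) ^ 2 ≤ (η ^ 2 * S + G * Q) ^ 2 := by
    have h1 : (η * J) ^ 2 ≤ 4 * (η ^ 2 * S) * (G * Q) := by
      rw [mul_pow]
      nlinarith [mul_le_mul_of_nonneg_left hJ (sq_nonneg η)]
    nlinarith [sq_nonneg (η ^ 2 * S - G * Q)]
  have hnn : 0 ≤ η ^ 2 * S + G * Q := add_nonneg (mul_nonneg (sq_nonneg _) hS) (mul_nonneg hG hQ)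
  have habs := abs_le_of_sq_le_sq' hsq hnn
  have hcross : -(η * J) ≤ η ^ 2 * S + G * Q := by linarith [habs.1]
  have hpe : 0 ≤ ψ' * e := mul_nonneg hψ he
  have key := mul_le_mul_of_nonneg_left hcross hpe
  nlinarith [key]

section Gradient

variable {n : ℕ} {M : Type*} [TopologicalSpace M] [T2Space M] [SecondCountableTopology M]
  [ChartedSpace (EuclideanSpace ℝ (Fin n)) M] [IsManifold (𝓡 n) ∞ M] [T3Space M]
  [MeasurableSpace M] [BorelSpace M]
  {g : PseudoRiemannianMetric (𝓡 n) ∞ (EuclideanSpace ℝ (Fin n)) (TangentSpace (𝓡 n) : M → Type _)}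
  [g.HasLeviCivita]

omit [T2Space M] [SecondCountableTopology M] [IsManifold (𝓡 n) ∞ M] [T3Space M] [MeasurableSpace M]
  [BorelSpace M] in
/-- The differential of an affine function of `u`: `d(a u + b) = a du`. [folklore] -/
theorem mvfderiv_affine_toLinearMap {u : M → ℝ} {x : M} (hu : MDifferentiableAt (𝓡 n) 𝓘(ℝ, ℝ) u x)
    (a b : ℝ) :
    (mvfderiv (𝓡 n) (fun y ↦ a * u y + b) x).toLinearMap = a • (mvfderiv (𝓡 n) u x).toLinearMap := by
  have hζ1 : HasDerivAt (fun t : ℝ ↦ a * t + b) a (u x) := by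
    simpa using ((hasDerivAt_id (u x)).const_mul a).add_const b
  have hcomp : (fun y ↦ a * u y + b) = (fun t : ℝ ↦ a * t + b) ∘ u := rfl
  ext v
  have h := mvfderiv_real_comp_apply (I := 𝓡 n) hζ1 hu v
  simpa [hcomp] using h

/-- **The dissipation inequality for the gradient subsolution, one first-order cut-off.** Let
`Ric + Hess V ≥ K g`, `ρ` smooth, `η ∈ C_c^∞`, `Ψ` smooth with `Ψ', Ψ'' ≥ 0`, `e ≥ 0`, `G₀ ∈ ℝ`,
`w = e |∇ρ|² − G₀`. Then
`∫ Ψ'(w) η² (Lw) e^{-V} + ∫ Ψ'(w) η² (e (2K|∇ρ|² + 2 g⁻¹(dρ, d(Lρ)) − L|∇ρ|²)) e^{-V}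
≤ 2 e ∫ Ψ'(w) |∇η|² |∇ρ|² e^{-V}`: the `η²`-Green identity
(`integral_mul_cutoffSq_mul_weightedLaplacian`), `Ψ'' ≥ 0`, and `slack_absorb` with
`innerDual_gradSq_sq_le_slack`. The second integrand is `Ψ'(w) η² (∂ₛw − Lw)` along the heat flow.
[cite: BakryGentilLedoux2014, Thm. 3.2.3 (proof, pp. 143–146)] -/
theorem integral_gradTest_dissipation_le (hg : g.IsRiemannian) {V : M → ℝ} {K : ℝ}
    (hV : ContMDiff (𝓡 n) 𝓘(ℝ, ℝ) ∞ V)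
    (hRic : ∀ (y : M) (X : TangentSpace (𝓡 n) y), K * g.val y X X ≤ g.ricci y X X + g.hessian V y X X)
    {ρ η : M → ℝ} (hρ : ContMDiff (𝓡 n) 𝓘(ℝ, ℝ) ∞ ρ) (hη : ContMDiff (𝓡 n) 𝓘(ℝ, ℝ) ∞ η)
    (hηc : HasCompactSupport η) {Ψ : ℝ → ℝ} (hΨ : ContDiff ℝ ∞ Ψ) (hΨ1 : ∀ t, 0 ≤ deriv Ψ t)
    (hΨ2 : ∀ t, 0 ≤ deriv (deriv Ψ) t) {e : ℝ} (he : 0 ≤ e) (G₀ : ℝ) :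
    (∫ x, deriv Ψ (e * g.gradSq ρ x + -G₀) * η x ^ 2 *
        (g.dalembertian (fun y ↦ e * g.gradSq ρ y + -G₀) x
          - g.innerDual x (mvfderiv (𝓡 n) V x).toLinearMap
            (mvfderiv (𝓡 n) (fun y ↦ e * g.gradSq ρ y + -G₀) x).toLinearMap) * Real.exp (-V x)
        ∂g.riemVolume)
      + ∫ x, deriv Ψ (e * g.gradSq ρ x + -G₀) * η x ^ 2 *
          (e * (2 * K * g.gradSq ρ x
            + 2 * g.innerDual x (mvfderiv (𝓡 n) ρ x).toLinearMap
              (mvfderiv (𝓡 n) (fun y ↦ g.dalembertian ρ y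
                - g.innerDual y (mvfderiv (𝓡 n) V y).toLinearMap (mvfderiv (𝓡 n) ρ y).toLinearMap)
                x).toLinearMap
            - (g.dalembertian (g.gradSq ρ) x - g.innerDual x (mvfderiv (𝓡 n) V x).toLinearMap
                (mvfderiv (𝓡 n) (g.gradSq ρ) x).toLinearMap))) * Real.exp (-V x) ∂g.riemVolume ≤
      2 * e * ∫ x, deriv Ψ (e * g.gradSq ρ x + -G₀) * (g.gradSq η x * g.gradSq ρ x) * Real.exp (-V x)
        ∂g.riemVolume := by
  haveI := CarrilloNi2009_shrinkerLSI.isFiniteMeasureOnCompacts_riemVolume hg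
  have h1le : (1 : ℕ∞ω) ≤ (∞ : ℕ∞ω) := WithTop.coe_le_coe.mpr le_top
  have h2le : (2 : ℕ∞ω) ≤ (∞ : ℕ∞ω) := WithTop.coe_le_coe.mpr le_top
  -- notation
  set Q : M → ℝ := g.gradSq ρ with hQdef
  have hQ : ContMDiff (𝓡 n) 𝓘(ℝ, ℝ) ∞ Q := contMDiff_gradSq g hρ
  set w : M → ℝ := fun y ↦ e * Q y + -G₀ with hwdef
  have hw : ContMDiff (𝓡 n) 𝓘(ℝ, ℝ) ∞ w := (contMDiff_const.mul hQ).add contMDiff_const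
  set Lρ : M → ℝ := fun y ↦ g.dalembertian ρ y
    - g.innerDual y (mvfderiv (𝓡 n) V y).toLinearMap (mvfderiv (𝓡 n) ρ y).toLinearMap with hLρ
  set S : M → ℝ := fun x ↦ (1 / 2) * (g.dalembertian Q x
      - g.innerDual x (mvfderiv (𝓡 n) V x).toLinearMap (mvfderiv (𝓡 n) Q x).toLinearMap)
    - g.innerDual x (mvfderiv (𝓡 n) ρ x).toLinearMap (mvfderiv (𝓡 n) Lρ x).toLinearMap
    - K * Q x with hSdef
  have hS0 : ∀ x, 0 ≤ S x := fun x ↦ by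
    have h := weightedBochner_pointwise_ge g hg hV hRic hρ x
    simp only [hSdef, hQdef, hLρ]
    linarith [h]
  have hslack : ∀ x, (g.innerDual x (mvfderiv (𝓡 n) η x).toLinearMap
      (mvfderiv (𝓡 n) Q x).toLinearMap) ^ 2 ≤ 4 * g.gradSq η x * Q x * S x := fun x ↦
    innerDual_gradSq_sq_le_slack g hg hV hRic hρ hη x
  -- the one-variable functions
  have hΨ' : ContDiff ℝ ∞ (deriv Ψ) := (contDiff_infty_iff_deriv.1 hΨ).2
  have hΨ'd : ∀ t, HasDerivAt (deriv Ψ) (deriv (deriv Ψ) t) t := fun t ↦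
    (hΨ'.differentiable (by simp) t).hasDerivAt
  -- the Green identity against `Ψ'(w) η²`
  have ha : ContMDiff (𝓡 n) 𝓘(ℝ, ℝ) ∞ (fun y ↦ deriv Ψ (w y)) := hΨ'.comp_contMDiff hw
  have hid := integral_mul_cutoffSq_mul_weightedLaplacian hg (a := fun y ↦ deriv Ψ (w y)) ha hw hη hηc hV
  -- chain rules
  have hwd : ∀ x, MDifferentiableAt (𝓡 n) 𝓘(ℝ, ℝ) w x := fun x ↦ hw.mdifferentiableAt (by simp)
  have hQd : ∀ x, MDifferentiableAt (𝓡 n) 𝓘(ℝ, ℝ) Q x := fun x ↦ hQ.mdifferentiableAt (by simp)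
  have hdw : ∀ x, (mvfderiv (𝓡 n) w x).toLinearMap = e • (mvfderiv (𝓡 n) Q x).toLinearMap := fun x ↦
    mvfderiv_affine_toLinearMap (hQd x) e (-G₀)
  have hch : ∀ x, (mvfderiv (𝓡 n) (fun y ↦ deriv Ψ (w y)) x).toLinearMap =
      deriv (deriv Ψ) (w x) • (mvfderiv (𝓡 n) w x).toLinearMap := fun x ↦ by
    ext v
    exact mvfderiv_real_comp_apply (I := 𝓡 n) (hΨ'd (w x)) (hwd x) v
  have hpt1 : ∀ x, g.innerDual x (mvfderiv (𝓡 n) (fun y ↦ deriv Ψ (w y)) x).toLinearMap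
      (mvfderiv (𝓡 n) w x).toLinearMap = deriv (deriv Ψ) (w x) * g.gradSq w x := fun x ↦ by
    rw [hch x, g.innerDual_smul_left]; rfl
  have hpt2 : ∀ x, g.innerDual x (mvfderiv (𝓡 n) η x).toLinearMap (mvfderiv (𝓡 n) w x).toLinearMap =
      e * g.innerDual x (mvfderiv (𝓡 n) η x).toLinearMap (mvfderiv (𝓡 n) Q x).toLinearMap := fun x ↦ by
    rw [hdw x, g.innerDual_smul_right]
  -- the pointwise inequality
  have hpt : ∀ x,
      (-(η x ^ 2 * g.innerDual x (mvfderiv (𝓡 n) (fun y ↦ deriv Ψ (w y)) x).toLinearMap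
          (mvfderiv (𝓡 n) w x).toLinearMap * Real.exp (-V x))
        - 2 * ((fun y ↦ deriv Ψ (w y)) x * η x * g.innerDual x (mvfderiv (𝓡 n) η x).toLinearMap
          (mvfderiv (𝓡 n) w x).toLinearMap * Real.exp (-V x)))
      + deriv Ψ (w x) * η x ^ 2 * (e * (2 * K * Q x
          + 2 * g.innerDual x (mvfderiv (𝓡 n) ρ x).toLinearMap (mvfderiv (𝓡 n) Lρ x).toLinearMap
          - (g.dalembertian Q x - g.innerDual x (mvfderiv (𝓡 n) V x).toLinearMap
              (mvfderiv (𝓡 n) Q x).toLinearMap))) * Real.exp (-V x) ≤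
      2 * e * (deriv Ψ (w x) * (g.gradSq η x * Q x) * Real.exp (-V x)) := by
    intro x
    rw [hpt1 x, hpt2 x]
    have hex : 0 ≤ Real.exp (-V x) := (Real.exp_pos _).le
    have hψ1 := hΨ1 (w x)
    have hψ2 := hΨ2 (w x)
    have hGw : 0 ≤ g.gradSq w x := g.gradSq_nonneg hg w x
    have hGη : 0 ≤ g.gradSq η x := g.gradSq_nonneg hg η x
    have hQ0 : 0 ≤ Q x := g.gradSq_nonneg hg ρ x
    -- `∂ₛw − Lw = −2 e S`
    have hsrc : e * (2 * K * Q x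
        + 2 * g.innerDual x (mvfderiv (𝓡 n) ρ x).toLinearMap (mvfderiv (𝓡 n) Lρ x).toLinearMap
        - (g.dalembertian Q x - g.innerDual x (mvfderiv (𝓡 n) V x).toLinearMap
            (mvfderiv (𝓡 n) Q x).toLinearMap)) = -(2 * e * S x) := by
      simp only [hSdef]; ring
    rw [hsrc]
    have habs := slack_absorb (η := η x) hψ1 he (hS0 x) hGη hQ0 (hslack x)
    -- drop the `Ψ''` term
    have hdrop : -(η x ^ 2 * (deriv (deriv Ψ) (w x) * g.gradSq w x) * Real.exp (-V x)) ≤ 0 := by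
      have : 0 ≤ η x ^ 2 * (deriv (deriv Ψ) (w x) * g.gradSq w x) * Real.exp (-V x) :=
        mul_nonneg (mul_nonneg (sq_nonneg _) (mul_nonneg hψ2 hGw)) hex
      linarith
    have key := mul_le_mul_of_nonneg_right habs hex
    nlinarith [key, hdrop]
  -- integrability (everything is continuous with compact support)
  have hec : Continuous fun x ↦ Real.exp (-V x) := Real.continuous_exp.comp hV.continuous.neg
  have hgradη : Continuous (g.gradSq η) := (contMDiff_gradSq g hη).continuous
  have hgradηs : HasCompactSupport (g.gradSq η) :=
    HasCompactSupport.intro hηc fun x hx ↦ gradSq_eq_zero_of_notMem_tsupport hx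
  have hη2c : HasCompactSupport (fun x ↦ η x ^ 2) := by
    rw [show (fun x ↦ η x ^ 2) = fun x ↦ η x * η x from funext fun x ↦ sq (η x)]
    exact hηc.mul_right
  have hV1 := hV.of_le h1le
  have hI1c : Continuous fun x ↦ g.innerDual x (mvfderiv (𝓡 n) (fun y ↦ deriv Ψ (w y)) x).toLinearMap
      (mvfderiv (𝓡 n) w x).toLinearMap := continuous_innerDual_mvfderiv g (ha.of_le h1le) (hw.of_le h1le)
  have hI2c : Continuous fun x ↦ g.innerDual x (mvfderiv (𝓡 n) η x).toLinearMap
      (mvfderiv (𝓡 n) w x).toLinearMap := continuous_innerDual_mvfderiv g (hη.of_le h1le) (hw.of_le h1le)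
  have hLρs : ContMDiff (𝓡 n) 𝓘(ℝ, ℝ) ∞ Lρ := (contMDiff_dalembertian g hρ).sub (contMDiff_innerDual g hV hρ)
  have hI3c : Continuous fun x ↦ g.innerDual x (mvfderiv (𝓡 n) ρ x).toLinearMap
      (mvfderiv (𝓡 n) Lρ x).toLinearMap := continuous_innerDual_mvfderiv g (hρ.of_le h1le) (hLρs.of_le h1le)
  have hLQc : Continuous fun x ↦ g.dalembertian Q x - g.innerDual x (mvfderiv (𝓡 n) V x).toLinearMap
      (mvfderiv (𝓡 n) Q x).toLinearMap :=
    (continuous_dalembertian g (hQ.of_le h2le)).sub (continuous_innerDual_mvfderiv g hV1 (hQ.of_le h1le))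
  have hψwc : Continuous fun x ↦ deriv Ψ (w x) := ha.continuous
  have iA : Integrable (fun x ↦ η x ^ 2 * g.innerDual x
      (mvfderiv (𝓡 n) (fun y ↦ deriv Ψ (w y)) x).toLinearMap (mvfderiv (𝓡 n) w x).toLinearMap *
      Real.exp (-V x)) g.riemVolume :=
    integrable_of_continuous_of_hasCompactSupport' hg (((hη.continuous.pow 2).mul hI1c).mul hec)
      (hη2c.mul_right.mul_right)
  have iB : Integrable (fun x ↦ (fun y ↦ deriv Ψ (w y)) x * η x * g.innerDual x
      (mvfderiv (𝓡 n) η x).toLinearMap (mvfderiv (𝓡 n) w x).toLinearMap * Real.exp (-V x)) g.riemVolume :=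
    integrable_of_continuous_of_hasCompactSupport' hg (((hψwc.mul hη.continuous).mul hI2c).mul hec)
      (((hηc.mul_left).mul_right).mul_right)
  have iC : Integrable (fun x ↦ deriv Ψ (w x) * η x ^ 2 * (e * (2 * K * Q x
      + 2 * g.innerDual x (mvfderiv (𝓡 n) ρ x).toLinearMap (mvfderiv (𝓡 n) Lρ x).toLinearMap
      - (g.dalembertian Q x - g.innerDual x (mvfderiv (𝓡 n) V x).toLinearMap
          (mvfderiv (𝓡 n) Q x).toLinearMap))) * Real.exp (-V x)) g.riemVolume := by
    refine integrable_of_continuous_of_hasCompactSupport' hg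
      (((hψwc.mul (hη.continuous.pow 2)).mul (continuous_const.mul
        (((continuous_const.mul hQ.continuous).add (continuous_const.mul hI3c)).sub hLQc))).mul hec) ?_
    exact ((hη2c.mul_left).mul_right).mul_right
  have iAn : Integrable (fun x ↦ -(η x ^ 2 * g.innerDual x
      (mvfderiv (𝓡 n) (fun y ↦ deriv Ψ (w y)) x).toLinearMap (mvfderiv (𝓡 n) w x).toLinearMap *
      Real.exp (-V x))) g.riemVolume := iA.neg
  have iB2 : Integrable (fun x ↦ 2 * ((fun y ↦ deriv Ψ (w y)) x * η x * g.innerDual x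
      (mvfderiv (𝓡 n) η x).toLinearMap (mvfderiv (𝓡 n) w x).toLinearMap * Real.exp (-V x))) g.riemVolume :=
    iB.const_mul 2
  have iL1 : Integrable (fun x ↦ -(η x ^ 2 * g.innerDual x
        (mvfderiv (𝓡 n) (fun y ↦ deriv Ψ (w y)) x).toLinearMap (mvfderiv (𝓡 n) w x).toLinearMap *
        Real.exp (-V x))
      - 2 * ((fun y ↦ deriv Ψ (w y)) x * η x * g.innerDual x (mvfderiv (𝓡 n) η x).toLinearMap
        (mvfderiv (𝓡 n) w x).toLinearMap * Real.exp (-V x))) g.riemVolume := iAn.sub iB2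
  have iL : Integrable (fun x ↦ (-(η x ^ 2 * g.innerDual x
        (mvfderiv (𝓡 n) (fun y ↦ deriv Ψ (w y)) x).toLinearMap (mvfderiv (𝓡 n) w x).toLinearMap *
        Real.exp (-V x))
      - 2 * ((fun y ↦ deriv Ψ (w y)) x * η x * g.innerDual x (mvfderiv (𝓡 n) η x).toLinearMap
        (mvfderiv (𝓡 n) w x).toLinearMap * Real.exp (-V x)))
      + deriv Ψ (w x) * η x ^ 2 * (e * (2 * K * Q x
          + 2 * g.innerDual x (mvfderiv (𝓡 n) ρ x).toLinearMap (mvfderiv (𝓡 n) Lρ x).toLinearMap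
          - (g.dalembertian Q x - g.innerDual x (mvfderiv (𝓡 n) V x).toLinearMap
              (mvfderiv (𝓡 n) Q x).toLinearMap))) * Real.exp (-V x)) g.riemVolume := iL1.add iC
  have iR : Integrable (fun x ↦ 2 * e * (deriv Ψ (w x) * (g.gradSq η x * Q x) * Real.exp (-V x)))
      g.riemVolume := by
    refine (integrable_of_continuous_of_hasCompactSupport' hg
      ((hψwc.mul (hgradη.mul hQ.continuous)).mul hec) ?_).const_mul (2 * e)
    exact ((hgradηs.mul_right).mul_left).mul_right
  have hmono := integral_mono iL iR hpt
  rw [integral_add iL1 iC, integral_sub iAn iB2, integral_neg,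
    integral_const_mul, integral_const_mul] at hmono
  rw [hid]
  exact hmono

end Gradient

end Summit.SmoothPoincare4.SmoothPoincare4.Theorems.BakryEmeryComplete

end
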